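import Summits.CriticalPhenomena.Ising3DConformalLimit.Theses.PerfectScreening
import Summits.CriticalPhenomena.Ising3DConformalLimit.Theses.EnergyNotSigmaSquared
import Summits.CriticalPhenomena.Ising3DConformalLimit.Theses.IsingEuclidUpgrade
import Summits.CriticalPhenomena.Ising3DConformalLimit.Theorems.MoebiusLimitExists.Negative.DeltaWindow
import Summits.CriticalPhenomena.Ising3DConformalLimit.Theorems.MoebiusLimitExists.Negative.CruxInversionOnly
import Summits.CriticalPhenomena.Ising3DConformalLimit.Theorems.EnergyNotSigmaSquaredMoebiusLimitExistsDefs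
import Summits.CriticalPhenomena.Ising3DConformalLimit.Theorems.EnergyNotSigmaSquaredMoebiusLimitExistsPinnedTwoPoint
import Summits.CriticalPhenomena.Ising3DConformalLimit.Theorems.EnergyNotSigmaSquaredMoebiusLimitExistsFreeClusterPointWick
import Summits.CriticalPhenomena.Ising3DConformalLimit.Theorems.EnergyNotSigmaSquaredMoebiusLimitExistsWickPowerMoebius
import Summits.CriticalPhenomena.Ising3DConformalLimit.Theorems.EnergyNotSigmaSquaredMoebiusLimitExistsCompactnessSchema
import Summits.CriticalPhenomena.Ising3DConformalLimit.Theorems.EnergyNotSigmaSquaredMoebiusLimitExistsLocallyBounded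
import Summits.CriticalPhenomena.Ising3DConformalLimit.Theorems.EnergyNotSigmaSquaredMoebiusLimitExistsTranslationInvariant
import Summits.CriticalPhenomena.Ising3DConformalLimit.Theorems.EnergyNotSigmaSquaredMoebiusLimitExistsEquicontinuousTwo
import Literature.Probability.LatticeModels.CriticalWickDichotomy
import Literature.Probability.LatticeModels.CriticalTwoPointBounds
import Literature.Barriers.CriticalPhenomena.BootstrapLatticeBlindness
import HarnessLib
import HarnessLib.Audit

/-!
# Line `only-interaction-breaks-moebius` for crux `MoebiusLimitExists` (stmt-CriticalPhenomena-1344)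

LEAD COPY (prover-line-stmt-CriticalPhenomena-1344-0, 2026-08-16): namespace moved to
`Summit.CriticalPhenomena.Ising3DConformalLimit.MoebiusLimitExistsOnlyInteraction`; the objects (`rhoPin`, `IsClusterPoint`,
`IsNormalised`, `IsRegular`, `powerKernel`, `wickPower`, `PinnedLimit`) and their API are the reviewed Defs file
`Theorems/EnergyNotSigmaSquaredMoebiusLimitExistsDefs.lean` (p71591); they stay INLINE below (marked) until that file lands,
then the block is replaced by the import. Stub names and signatures are unchanged (registered).

CHECKED SKELETON (crux-plan; planner-cruxplan-stmt-CriticalPhenomena-1344-only-interaction-bre-0,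
2026-08-15). Idea card `Cruxes/MoebiusLimitExists/Ideas/only-interaction-breaks-moebius.md`, MERGED —
as all three triagers asked (TRIAGE-r1-1/2/3: "plan as ONE cluster-set line, card 2 = the free-branch
stub of card 1's (U𝒞)") — with the cluster-set schema of `invert-the-cluster-points`.

The crux (`PerfectScreening.MoebiusLimitExists` = `EnergyNotSigmaSquared.MoebiusLimit`, one term,
11 routes): `∃ ρ Δ S, ρ > 0 on (0,1] ∧ 0 < Δ ∧ HasPointwiseScalingLimit (criticalCorr 3) ρ S ∧
IsNondegenerateTwoPoint S ∧ IsMoebiusCovariant Δ S` — the conjunct minus clause (iii).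

THE LINE. Pin the renormalisation, `ρ_pin(δ) := ⟨σ₀σ_{⌊1/δ⌋e₀}⟩_{β_c}^{-1/2}` (`rhoPin`), and work on
the CLUSTER SET of the pinned zoom (`IsClusterPoint`: locally uniform limits off the diagonals along a
mesh SEQUENCE, one sequence for all `n`). Given the two-point law (item stmt-0634
`IsingEuclidUpgradeR2RotInvPowerLaw`, hypothesis BY NAME) every cluster point has the SAME two-point
function `‖x−y‖^{-2Δ}` (`stub_pinnedTwoPoint`), hence is non-degenerate. Then ONLY INTERACTION CAN
BREAK MÖBIUS: a cluster point with `U₄ ≡ 0` off the diagonals is, by the SEQUENTIAL form of the tree's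
Gaussian dichotomy (Aizenman 1982 Prop. 12.1 ⇒ Wick at all orders, PROVED for full limits in
`Literature/Probability/LatticeModels/CriticalWickDichotomy.lean`), the Wick family `wickPower Δ` of
the pure power (`stub_freeClusterPointWick`), and that family is Möbius covariant for every `Δ`
(`stub_wickPowerMoebius`). So the free stratum of the cluster set is the single point `W_Δ`, and the
crux reduces to three statements about INTERACTING (`HasNontrivialU4`) REGULAR cluster points —
which the engines may now assume interacting: sequential COMPACTNESS with regular cluster points
(`stub_compactness`), INVERSION COVARIANCE of interacting regular cluster points
(`stub_interactingInversion`, the hardest, = card 1's (I𝒞) restricted to the interacting stratum,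
`Δ` pinned by the two-point law) and UNIQUENESS anchored at an interacting cluster point
(`stub_interactingUnique`, = card 1's (U𝒞) on the interacting stratum; it also excludes coexistence
of free and interacting cluster points). Rotations and dilations are OUTPUT: for a non-degenerate
pointwise limit of `criticalCorr 3`, translations, `O(3)` and dilations are FREE given inversion
covariance (standing disprover, landed `Negative/CruxInversionOnly.lean`:
`MoebiusLimitExistsNegative.moebiusLimit_iff_inversion`; RESHAPE 2026-08-16 — the word-lemma item
stmt-4726 is no longer a hypothesis of this line); existence is OUTPUT: the tree's subsequence principle
`hasPointwiseScalingLimit_of_seq_subseq`; `0 < Δ` is OUTPUT: landed Negative theorem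
`MoebiusLimitExistsNegative.moebiusLimit_iff_without_delta_pos` (`Δ ∈ [1/2,1]` is forced).

`MoebiusLimitExists_of` composes the stubs and the ONE named item 0634 into the crux BY NAME
(kernel-checked; the only `sorry`s of this file sit inside the `stub_*` theorems). STATE 2026-08-16
(lead prover-line-stmt-CriticalPhenomena-1344-0): LANDED stubs 2, 3, 4 (`…PinnedTwoPoint.lean` p72027,
`…FreeClusterPointWick.lean` p72282, `…WickPowerMoebius.lean` p72440) and the sub-goals of stub 1
(`…CompactnessSchema.lean` p72765, `…LocallyBounded.lean` p73886, `…TranslationInvariant.lean` p74332);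
the sub-goal
`…EquicontinuousTwo.lean` p75905; stub 1 is now the theorem `pinnedZoom_compactness` modulo the
registered residue `stub_equicontinuity_ge_four`, stubs 5 and 6 are the theorems
`isInversionCovariant_of_ge_four` / `eqOn_of_ge_four` modulo the registered residues
`stub_interactingInversion_ge_four` / `stub_interactingUnique_ge_four` (orders 0, odd, 2 are free);
OPEN: exactly these three residues, all living at even orders `≥ 4` — each implied by the crux (refuter, landed
`Negative/OnlyInteractionTightness.lean`, `Negative/PinnedClusterPoints.lean`) and each FALSE without
the lattice provenance `IsClusterPoint` (landed `Negative/StubsNeedLattice.lean`,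
`Negative/StubsWithoutLattice.lean`). The card's C2/C3
are the kernel-checked `pinnedLimit_of_allFree` (free branch ⇒ crux, stubs 1–4 only) and
`interacting_clusterPoint_of_not_crux` (0634 ∧ stubs 1–4 ∧ ¬crux ⇒ an interacting regular cluster
point exists: failure of the crux is a certificate of interaction).

DISPROOF USED (`Cruxes/MoebiusLimitExists/Disproof.lean`, gen 2 "resists"; it has no
`_false_without_` theorem — its §A clause analysis plays that role): `cruxWithoutLimit_holds` (the
lattice-limit clause is the load-bearing one) — honoured: the limit is consumed by stubs 1, 2, 3, 5, 6
along mesh sequences, never replaced by covariance data; `cruxWithoutNondegeneracy_holds` — honoured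
by PINNING (`rhoPin`, every cluster point has `S₂ = ‖x−y‖^{-2Δ} > 0`, no killing renormalisation);
`crux_iff_normalised` — cluster points delivered by `stub_compactness` are normalised (`IsRegular`);
§C junk variants `not_cruxWithInversionAtOrigin` (inversion only off the origin: we use the tree's
`IsInversionCovariant`), `not_cruxWithContinuousTwoPoint` (continuity is asked on `NonCoincident`
ONLY, inside `IsRegular`), `not_cruxWithUniformLimit` (all convergence clauses are
`TendstoLocallyUniformlyOn`), `witness_delta_mem_Icc` / landed `Negative/DeltaWindow.lean` (used:
`moebiusLimit_iff_without_delta_pos` discharges `0 < Δ`). No landed `Negative/` lemma refutes an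
instance of any stub (DeltaWindow/EtaExists/ScaleFree/RatioRegular constrain witnesses; our witness
has the 0634 exponent `Δ`, consistent with `Δ ∈ [1/2, 3/4]`).
-/

noncomputable section

open Filter Topology Set Function
open Literature.Probability.LatticeModels Literature.Barriers.CriticalPhenomena

namespace Summit.CriticalPhenomena.Ising3DConformalLimit.MoebiusLimitExistsOnlyInteraction

set_option linter.unusedVariables false

/-! ## Objects of the line: see `Theorems/EnergyNotSigmaSquaredMoebiusLimitExistsDefs.lean` (imported) -/

/-! ## The registered stubs -/

/-! ### STUB 1″ reshaped (lead prover-line-stmt-CriticalPhenomena-1344-1, 2026-08-16): asymptotic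
equicontinuity of the pinned `2m`-point zoom, `m ≥ 2`, is PROVED below (`stub_equicontinuity_ge_four`, now a
theorem) from three registered pieces:
* `telescoping_equicontinuity` (toolkit, pure topology, provable now): single-variable asymptotic
  equicontinuity on every compact subset of an open set `s ⊆ (ℝ³)ᴺ` ⇒ joint asymptotic equicontinuity on
  every compact subset of `s` (hybrid configurations inside a compact thickening);
* `sepMove_equicontinuity` (toolkit, provable now) — the REFLECTION-POSITIVITY TRANSFER: from the lattice
  move inequality `moveIneq_latticeRP` (toolkit, provable now from the tree's site-mirror RP of
  `criticalCorr 3`, `…HyperoctahedralRPInversionUpgradeNormalisedLatticeRP.stub_latticeRP`) and the 0634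
  two-point asymptotics, the pinned zoom is asymptotically equicontinuous under moves of ONE point that is
  separated from all the others by a coordinate slab of macroscopic width `κ`;
* `stub_equicontinuity_inner` (OPEN, the honest residue): the same single-variable statement when the
  moving point lies within `κ` of the closed coordinate bounding box of the other points, for SOME `κ > 0`
  (prover's choice) — this is where Harnack-type regularity of the critical multi-spin correlations of `ℤ³`
  lives (no separating mirror; next reshapes: the six diagonal mirrors `eᵢ ± eⱼ`, and rigid normal moves of
  separated CLUSTERS via Hankel positivity `a_{i+i'} = ⟨σ_{θ(B+ie)}σ_{B+i'e}⟩`). -/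

/-- **STUB 1″a — the RP–Cauchy–Schwarz MOVE INEQUALITY on the lattice (toolkit, provable now, size M).**
Fix a coordinate `τ`, an integer height `c` and the site mirror `θ v = (v with v_τ ↦ 2c − v_τ)` of `ℤ³` in
the plane `{v_τ = c}`. If two configurations `y, y'` of `n + 1` sites differ only at the index `i`, the
moving site lies weakly on ONE closed side of the mirror in both (`y i τ, y' i τ ≤ c`, resp. `≥ c`) and all
other sites weakly on the OTHER closed side (`c ≤ y j τ`, resp. `y j τ ≤ c`), then
`(⟨∏σ_y⟩ − ⟨∏σ_{y'}⟩)² ≤ [G(yᵢ − θyᵢ) − 2G(yᵢ − θy'ᵢ) + G(y'ᵢ − θy'ᵢ)] · ⟨∏ⱼ σ_{θyⱼ} ∏ⱼ σ_{yⱼ}⟩_{j ≠ i}`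
(`G = criticalTwoPoint 3`, all correlators critical, infinite volume). Proof: the Gram form
`(a, b) ↦ ⟨σ_{θzᵃ} σ_{zᵇ}⟩_{β_c}` on spin monomials supported in the closed half-lattice `{v_τ ≥ c}` is
positive semidefinite — `stub_latticeRP` for the plane through the origin, transported by the lattice
translation `c e_τ` (`criticalCorr_translate`) — and a PSD form `Q` satisfies
`Q(F − F', G)² ≤ Q(F − F', F − F') Q(G, G)`; take `F = σ_{θyᵢ}`, `F' = σ_{θy'ᵢ}`, `G = ∏_{j≠i} σ_{yⱼ}`,
so that `Q(F, G) = ⟨σ_{yᵢ} ∏_{j≠i}σ_{yⱼ}⟩ = ⟨∏σ_y⟩` (permutation invariance `criticalCorr_comp_perm`,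
mirror invariance `criticalCorr_signedPerm`/`criticalCorr_axisRefl`, `criticalCorr_two`/evenness of `G`).
[cite: FILS1978, §2] [cite: FriedliVelenik2017, Lemma 10.8] -/
theorem moveIneq_latticeRP :
    ∀ (τ : Fin 3) (c : ℤ) (n : ℕ) (i : Fin (n + 1)) (y y' : Fin (n + 1) → Site 3),
      (∀ j, j ≠ i → y' j = y j) →
      ((y i τ ≤ c ∧ y' i τ ≤ c ∧ ∀ j, j ≠ i → c ≤ y j τ) ∨
        (c ≤ y i τ ∧ c ≤ y' i τ ∧ ∀ j, j ≠ i → y j τ ≤ c)) →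
      (criticalCorr 3 (n + 1) y - criticalCorr 3 (n + 1) y') ^ 2 ≤
        (criticalTwoPoint 3 (y i - Function.update (y i) τ (2 * c - y i τ))
          - 2 * criticalTwoPoint 3 (y i - Function.update (y' i) τ (2 * c - y' i τ))
          + criticalTwoPoint 3 (y' i - Function.update (y' i) τ (2 * c - y' i τ))) *
        criticalCorr 3 (n + n)
          (Fin.append (fun j => Function.update (y (i.succAbove j)) τ (2 * c - y (i.succAbove j) τ))
            (fun j => y (i.succAbove j))) := by
  sorry

/-- **STUB 1″b — REFLECTION-POSITIVITY TRANSFER: asymptotic equicontinuity under moves of a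
COORDINATE-SEPARATED point (toolkit, provable now, size L).** Granted the lattice move inequality
(the statement of `moveIneq_latticeRP`, taken as a hypothesis so that this piece is independent) and the
two-point law `⟨σ₀σ_y⟩_{β_c}‖y‖₂^{2Δ} → c > 0` (item 0634's data): along every mesh sequence `u k → 0⁺`,
on every compact set `K` of non-coincident `N`-point configurations, for every margin `κ > 0` and index
`i`, the pinned rescaled critical correlators `F_k = ρ_pin(u k)ᴺ ⟨∏ σ_{[x_j/u k]}⟩_{β_c}` satisfy: for
every `ε > 0` there is `η > 0` such that eventually in `k`, `|F_k x − F_k x'| < ε` whenever `x, x' ∈ K`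
differ only at the index `i`, `dist x x' < η`, and the point `x i` is separated from all the other points
by a coordinate slab of width `κ` (`x i τ + κ ≤ x j τ` for all `j ≠ i`, or `x j τ + κ ≤ x i τ` for all
`j ≠ i`, for some `τ`). Why true: put the lattice mirror at height `c = ⌊(x i τ + κ/2)/δ⌋` (resp. the
symmetric choice); by the move inequality `(F_k x − F_k x')²` is at most
`ρ_pin²[G(v₀) − 2G(v₁) + G(v₂)] · ρ_pin^{2(N−1)}⟨σ_{θB}σ_B⟩` with three lattice vectors `vₗ` of
macroscopic length `δ‖vₗ‖ ∈ [κ − 4η, κ + 4η]` (eventually), so by the UNIFORM two-point asymptotics at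
scale (`ρ_pin(δ)² G(v) − (δ‖v‖₂)^{-2Δ} → 0` uniformly for `δ‖v‖` in a compact subinterval of `(0,∞)`,
from the cofinite convergence and `ρ_pin² = 1/G(⌊1/δ⌋e₀)`) the first factor is
`≤ 12·Lip(t ↦ t^{-2Δ} on [κ/2, 2κ])·η + o(1)`, while the second is eventually bounded on `K` by Newman's
Gaussian inequality (`criticalCorr_le_pairingSum`, `pairingSum_le_factorial_mul_pow`) since all `2(N−1)`
sites of `(θB, B)` are pairwise `≥ min(sep K, κ)/δ − 2` apart; odd `N` is trivial
(`criticalCorr_eq_zero_of_odd`), `N = 0` is vacuous. [cite: FILS1978, §2]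
[cite: DuminilCopinICM2022, §8.1 eq. (8.1)–(8.2)] -/
theorem sepMove_equicontinuity :
    (∀ (τ : Fin 3) (c : ℤ) (n : ℕ) (i : Fin (n + 1)) (y y' : Fin (n + 1) → Site 3),
      (∀ j, j ≠ i → y' j = y j) →
      ((y i τ ≤ c ∧ y' i τ ≤ c ∧ ∀ j, j ≠ i → c ≤ y j τ) ∨
        (c ≤ y i τ ∧ c ≤ y' i τ ∧ ∀ j, j ≠ i → y j τ ≤ c)) →
      (criticalCorr 3 (n + 1) y - criticalCorr 3 (n + 1) y') ^ 2 ≤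
        (criticalTwoPoint 3 (y i - Function.update (y i) τ (2 * c - y i τ))
          - 2 * criticalTwoPoint 3 (y i - Function.update (y' i) τ (2 * c - y' i τ))
          + criticalTwoPoint 3 (y' i - Function.update (y' i) τ (2 * c - y' i τ))) *
        criticalCorr 3 (n + n)
          (Fin.append (fun j => Function.update (y (i.succAbove j)) τ (2 * c - y (i.succAbove j) τ))
            (fun j => y (i.succAbove j)))) →
    ∀ (Δ c : ℝ), 0 < c →
      Tendsto (fun y : Site 3 => criticalTwoPoint 3 y * Real.sqrt (∑ i, ((y i : ℝ)) ^ 2) ^ (2 * Δ))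
        cofinite (𝓝 c) →
      ∀ u : ℕ → ℝ, Tendsto u atTop (𝓝[>] (0 : ℝ)) →
        ∀ (N : ℕ) (K : Set (Fin N → EuclideanSpace ℝ (Fin 3))), IsCompact K → K ⊆ NonCoincident 3 N →
          ∀ κ : ℝ, 0 < κ → ∀ i : Fin N, ∀ ε > 0, ∃ η > 0, ∀ᶠ k in atTop, ∀ x ∈ K, ∀ x' ∈ K,
            (∀ j, j ≠ i → x' j = x j) →
            (∃ τ : Fin 3, (∀ j, j ≠ i → x i τ + κ ≤ x j τ) ∨ (∀ j, j ≠ i → x j τ + κ ≤ x i τ)) →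
            dist x x' < η →
              |rescaledCorrelator (criticalCorr 3) rhoPin N (u k) x -
                rescaledCorrelator (criticalCorr 3) rhoPin N (u k) x'| < ε := by
  sorry

/-- **STUB 1″c — TELESCOPING: single-variable ⇒ joint asymptotic equicontinuity (toolkit, pure
topology, provable now, size S–M).** For functions `F k` on `(ℝ³)ᴺ` and an open set `s`: if on every
compact `K' ⊆ s` and for every index `i` the family is asymptotically equicontinuous under moves of the
`i`-th point alone, then it is asymptotically equicontinuous on every compact `K ⊆ s`. Proof: choose
`r > 0` with the closed `r`-thickening `K'` of `K` inside `s` (`IsCompact.exists_cthickening_subset_open`;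
`K'` is compact in the proper space `(ℝ³)ᴺ`); for `x, y ∈ K` with `dist x y < η ≤ r` the hybrid
configurations `z_l = (y₀,…,y_{l−1}, x_l,…,x_{N−1})` lie in `K'` (sup metric: `dist z_l x ≤ dist y x`),
consecutive hybrids differ in one coordinate and are `< η` apart, and the `N` increments are each
`< ε/N` eventually (finite intersection of eventualities; `N = 0` is trivial). [folklore] -/
theorem telescoping_equicontinuity :
    ∀ (N : ℕ) (F : ℕ → (Fin N → EuclideanSpace ℝ (Fin 3)) → ℝ)
      (s : Set (Fin N → EuclideanSpace ℝ (Fin 3))), IsOpen s →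
      (∀ K' : Set (Fin N → EuclideanSpace ℝ (Fin 3)), IsCompact K' → K' ⊆ s →
        ∀ i : Fin N, ∀ ε > 0, ∃ η > 0, ∀ᶠ k in atTop, ∀ x ∈ K', ∀ x' ∈ K',
          (∀ j, j ≠ i → x' j = x j) → dist x x' < η → |F k x - F k x'| < ε) →
      ∀ K : Set (Fin N → EuclideanSpace ℝ (Fin 3)), IsCompact K → K ⊆ s →
        ∀ ε > 0, ∃ η > 0, ∀ᶠ k in atTop, ∀ x ∈ K, ∀ y ∈ K, dist x y < η → |F k x - F k y| < ε := by
  sorry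

/-- **STUB 1″d — THE RESIDUE: single-variable asymptotic equicontinuity at NON-SEPARATED points
(OPEN, size L–XL; lead's stub).** Under the two-point law, along every mesh sequence, on every compact
set `K` of non-coincident `N`-point configurations and for every index `i` there is a margin `κ > 0`
(prover's choice) such that the pinned rescaled critical correlators are asymptotically equicontinuous
under moves of the `i`-th point alone at all configurations `x ∈ K` whose `i`-th point is NOT separated
from the others by a coordinate slab of width `κ` — i.e. lies within `κ` of the closed coordinate
bounding box of the other points. Together with `sepMove_equicontinuity` (which serves every `κ`) and
`telescoping_equicontinuity` this is exactly the former STUB 1″ (`stub_equicontinuity_ge_four`, proved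
below). What is known toward it: the on-axis two-point case is a theorem (`Negative/AxisRatioRegularity`);
reflection positivity in the six DIAGONAL mirrors `eᵢ ± eⱼ` (FILS 1978 §2 for the coordinate-swap
automorphisms of `ℤ³`, same proof as `stub_latticeRP`) extends `sepMove_equicontinuity` to points outside
the `B₃`-zonotope hull of the others; rigid moves of a mirror-separated CLUSTER `P` in the normal
direction are Lipschitz at scale by Hankel positivity of `k ↦ ⟨σ_{θP}σ_{P+ke}⟩` (log-convexity along even
`k` + two-sided power bounds, the argument of `Negative/AxisRatioRegularity`), and arbitrary small moves of
an UNBALANCED separated cluster (`|P| < N/2`) cost the `2|P|`-point regularity at the doubled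
configuration `P ∪ θP` (induction on `N`); what no mirror argument reaches is a point (or balanced
cluster) with no separating mirror in any of the nine directions, e.g. each half of an axis-parallel
`2×2×2` cube. Implied by the crux (`Negative/AsympEquicontinuity.schemaInputs_of_crux`). Known in `d = 2`
only (RSW). [cite: DuminilCopinICM2022, §8.4 p. 29] [cite: AizenmanDuminilCopinAnnals2021, arXiv:1912.07973 Remark 5.10 and Def. 5.11] -/
theorem stub_equicontinuity_inner :
    ∀ (Δ c : ℝ), 0 < c →
      Tendsto (fun y : Site 3 => criticalTwoPoint 3 y * Real.sqrt (∑ i, ((y i : ℝ)) ^ 2) ^ (2 * Δ))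
        cofinite (𝓝 c) →
      ∀ u : ℕ → ℝ, Tendsto u atTop (𝓝[>] (0 : ℝ)) →
        ∀ (N : ℕ) (K : Set (Fin N → EuclideanSpace ℝ (Fin 3))), IsCompact K → K ⊆ NonCoincident 3 N →
          ∀ i : Fin N, ∃ κ > 0, ∀ ε > 0, ∃ η > 0, ∀ᶠ k in atTop, ∀ x ∈ K, ∀ x' ∈ K,
            (∀ j, j ≠ i → x' j = x j) →
            ¬ (∃ τ : Fin 3, (∀ j, j ≠ i → x i τ + κ ≤ x j τ) ∨ (∀ j, j ≠ i → x j τ + κ ≤ x i τ)) →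
            dist x x' < η →
              |rescaledCorrelator (criticalCorr 3) rhoPin N (u k) x -
                rescaledCorrelator (criticalCorr 3) rhoPin N (u k) x'| < ε := by
  sorry

/-- **Single-variable asymptotic equicontinuity of the pinned zoom at every configuration**, from the
separated case (`sepMove_equicontinuity ∘ moveIneq_latticeRP`, every margin `κ`) and the residue
(`stub_equicontinuity_inner`, its own margin `κ`). [folklore] -/
theorem pinnedZoom_singleVariable_equicontinuity {Δ c : ℝ} (hc : 0 < c)
    (hG : Tendsto (fun y : Site 3 => criticalTwoPoint 3 y * Real.sqrt (∑ i, ((y i : ℝ)) ^ 2) ^ (2 * Δ))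
      cofinite (𝓝 c))
    {u : ℕ → ℝ} (hu : Tendsto u atTop (𝓝[>] (0 : ℝ))) (N : ℕ)
    (K : Set (Fin N → EuclideanSpace ℝ (Fin 3))) (hK : IsCompact K) (hKs : K ⊆ NonCoincident 3 N)
    (i : Fin N) :
    ∀ ε > 0, ∃ η > 0, ∀ᶠ k in atTop, ∀ x ∈ K, ∀ x' ∈ K,
      (∀ j, j ≠ i → x' j = x j) → dist x x' < η →
        |rescaledCorrelator (criticalCorr 3) rhoPin N (u k) x -
          rescaledCorrelator (criticalCorr 3) rhoPin N (u k) x'| < ε := by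
  intro ε hε
  obtain ⟨κ, hκ, hin⟩ := stub_equicontinuity_inner Δ c hc hG u hu N K hK hKs i
  obtain ⟨η₁, hη₁, h₁⟩ := hin ε hε
  obtain ⟨η₂, hη₂, h₂⟩ :=
    sepMove_equicontinuity moveIneq_latticeRP Δ c hc hG u hu N K hK hKs κ hκ i ε hε
  refine ⟨min η₁ η₂, lt_min hη₁ hη₂, ?_⟩
  filter_upwards [h₁, h₂] with k hk₁ hk₂ x hx x' hx' hdiff hdist
  by_cases hsep : ∃ τ : Fin 3, (∀ j, j ≠ i → x i τ + κ ≤ x j τ) ∨ (∀ j, j ≠ i → x j τ + κ ≤ x i τ)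
  · exact hk₂ x hx x' hx' hdiff hsep (lt_of_lt_of_le hdist (min_le_right _ _))
  · exact hk₁ x hx x' hx' hdiff hsep (lt_of_lt_of_le hdist (min_le_left _ _))

/-- **The former STUB 1″ — ASYMPTOTIC EQUICONTINUITY of the pinned `2m`-point zoom off the diagonals,
`m ≥ 2`, now PROVED modulo `stub_equicontinuity_inner` (and the provable toolkit pieces
`moveIneq_latticeRP`, `sepMove_equicontinuity`, `telescoping_equicontinuity`).** Under the two-point
law (item 0634's data as hypotheses), along every mesh sequence `u k → 0⁺` and on every compact set `K`
of non-coincident `2m`-point configurations, for every `ε > 0` there is `η > 0` such that eventually in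
`k`, `|F(x) − F(y)| < ε` whenever `x, y ∈ K`, `dist x y < η`. Implied by the crux (refuter, landed
`Negative/OnlyInteractionTightness.lean`, `Negative/AsympEquicontinuity.lean`).
[cite: DuminilCopinICM2022, §8.4 p. 29] -/
theorem stub_equicontinuity_ge_four :
    ∀ (Δ c : ℝ), 0 < c →
      Tendsto (fun y : Site 3 => criticalTwoPoint 3 y * Real.sqrt (∑ i, ((y i : ℝ)) ^ 2) ^ (2 * Δ))
        cofinite (𝓝 c) →
      ∀ u : ℕ → ℝ, Tendsto u atTop (𝓝[>] (0 : ℝ)) →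
        ∀ m : ℕ, 2 ≤ m →
          ∀ (K : Set (Fin (2 * m) → EuclideanSpace ℝ (Fin 3))), IsCompact K → K ⊆ NonCoincident 3 (2 * m) →
            ∀ ε > 0, ∃ η > 0, ∀ᶠ k in atTop, ∀ x ∈ K, ∀ y ∈ K, dist x y < η →
              |rescaledCorrelator (criticalCorr 3) rhoPin (2 * m) (u k) x -
                rescaledCorrelator (criticalCorr 3) rhoPin (2 * m) (u k) y| < ε := by
  intro Δ c hc hG u hu m _hm K hK hKs
  exact telescoping_equicontinuity (2 * m)
    (fun k x => rescaledCorrelator (criticalCorr 3) rhoPin (2 * m) (u k) x) (NonCoincident 3 (2 * m))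
    (isOpen_nonCoincident 3 (2 * m))
    (fun K' hK' hK's i => pinnedZoom_singleVariable_equicontinuity hc hG hu (2 * m) K' hK' hK's i) K hK hKs

/-- **Asymptotic equicontinuity of the pinned zoom at ALL orders, modulo STUB 1″**: order `0` is the
constant `1`, odd orders vanish identically (`criticalCorr_eq_zero_of_odd`, `m*(β_c) = 0`), order `2` is
the landed `pinnedZoomEquicontinuous_two`, even orders `≥ 4` are `stub_equicontinuity_ge_four`. [folklore] -/
theorem pinnedZoom_equicontinuity :
    ∀ (Δ c : ℝ), 0 < c →
      Tendsto (fun y : Site 3 => criticalTwoPoint 3 y * Real.sqrt (∑ i, ((y i : ℝ)) ^ 2) ^ (2 * Δ))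
        cofinite (𝓝 c) →
      ∀ u : ℕ → ℝ, Tendsto u atTop (𝓝[>] (0 : ℝ)) →
        ∀ n (K : Set (Fin n → EuclideanSpace ℝ (Fin 3))), IsCompact K → K ⊆ NonCoincident 3 n →
          ∀ ε > 0, ∃ η > 0, ∀ᶠ k in atTop, ∀ x ∈ K, ∀ y ∈ K, dist x y < η →
            |rescaledCorrelator (criticalCorr 3) rhoPin n (u k) x -
              rescaledCorrelator (criticalCorr 3) rhoPin n (u k) y| < ε := by
  intro Δ c hc hG u hu n K hK hKs ε hε
  rcases Nat.even_or_odd n with ⟨m, hm⟩ | hodd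
  · obtain rfl : n = 2 * m := by omega
    rcases Nat.lt_or_ge m 2 with hm2 | hm2
    · interval_cases m
      · -- order 0: the configuration space is a single point
        refine ⟨1, one_pos, Filter.Eventually.of_forall fun k x _ y _ _ => ?_⟩
        have hxy : x = y := funext fun i => absurd i.2 (by omega)
        subst hxy
        simpa using hε
      · exact pinnedZoomEquicontinuous_two Δ c hc hG u hu K hK hKs ε hε
    · exact stub_equicontinuity_ge_four Δ c hc hG u hu m hm2 K hK hKs ε hε
  · -- odd orders vanish identically on the lattice
    refine ⟨1, one_pos, Filter.Eventually.of_forall fun k x _ y _ _ => ?_⟩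
    rw [rescaledCorrelator_apply, rescaledCorrelator_apply, criticalCorr_eq_zero_of_odd (d := 3) le_rfl hodd,
      criticalCorr_eq_zero_of_odd (d := 3) le_rfl hodd]
    simpa using hε

/-- **COMPACTNESS of the pinned zoom with REGULAR cluster points — the former STUB 1, now PROVED modulo
`stub_equicontinuity_ge_four`** from the landed sub-goals `compactnessSchema` (abstract Arzelà–Ascoli / Cantor
diagonal, p72765), `pinnedZoomLocallyBounded` (Gaussian pairing bound + two-point doubling under 0634,
p73886) and `pinnedZoomTranslationInvariant` (equicontinuity + lattice translation invariance, p74332):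
under the two-point law every mesh sequence `u k → 0⁺` has a subsequence along which, for every `n` at
once, the pinned rescaled critical correlators converge locally uniformly off the diagonals to a
normalised, continuous-off-diagonals, translation-invariant family. [folklore] -/
theorem pinnedZoom_compactness {Δ c : ℝ} (hc : 0 < c)
    (hG : Tendsto (fun y : Site 3 => criticalTwoPoint 3 y * Real.sqrt (∑ i, ((y i : ℝ)) ^ 2) ^ (2 * Δ))
      cofinite (𝓝 c)) :
    ∀ u : ℕ → ℝ, Tendsto u atTop (𝓝[>] (0 : ℝ)) →
      ∃ (φ : ℕ → ℕ) (S : CorrFamily 3), StrictMono φ ∧ IsRegular S ∧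
        ∀ n, TendstoLocallyUniformlyOn
          (fun k => rescaledCorrelator (criticalCorr 3) rhoPin n (u (φ k))) (S n) atTop
          (NonCoincident 3 n) := by
  intro u hu
  obtain ⟨φ, S, hφ, hnorm, hcont, hconv⟩ := compactnessSchema
    (fun n k x => rescaledCorrelator (criticalCorr 3) rhoPin n (u k) x)
    (fun n K hK hKs => pinnedZoomLocallyBounded Δ c hc hG u hu n K hK hKs)
    (fun n K hK hKs => pinnedZoom_equicontinuity Δ c hc hG u hu n K hK hKs)
  have hu' : Tendsto (u ∘ φ) atTop (𝓝[>] (0 : ℝ)) := hu.comp hφ.tendsto_atTop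
  refine ⟨φ, S, hφ, ⟨hnorm, hcont, ?_⟩, hconv⟩
  exact pinnedZoomTranslationInvariant (u ∘ φ) hu'
    (fun n K hK hKs => pinnedZoom_equicontinuity Δ c hc hG (u ∘ φ) hu' n K hK hKs) S hnorm hconv

/-! STUBS 2–4 LANDED (imported): `stub_pinnedTwoPoint` (p72027, …PinnedTwoPoint.lean),
`stub_freeClusterPointWick` (p72282, …FreeClusterPointWick.lean), `stub_wickPowerMoebius` (p72440, …WickPowerMoebius.lean). -/

/-! ### Low orders of regular cluster points are free (orders `0`, odd, `2`) -/

/-- `⟨1⟩_{β_c} = 1`: the critical correlator of the empty configuration. [folklore] -/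
theorem criticalCorr_orderZero_eq_one (y : Fin 0 → Site 3) : criticalCorr 3 0 y = 1 := by
  have hy : spinMonomial y = fun _ => (1:ℝ) := by
    funext s; simp [spinMonomial]
  show plusExpect 3 (criticalBeta 3) 0 (spinMonomial y) = 1
  rw [hy]
  show limUnder atTop
      (fun L : ℕ => isingExpect (zdGraph 3) (box 3 L) (criticalBeta 3) 0 .plus (fun _ => (1:ℝ))) = 1
  simp_rw [isingExpect_const]
  exact tendsto_const_nhds.limUnder_eq

/-- Order `0` of a cluster point is `1`. [folklore] -/
theorem IsClusterPoint.orderZero_eq_one {S : CorrFamily 3} (hS : IsClusterPoint S)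
    (x : Fin 0 → EuclideanSpace ℝ (Fin 3)) : S 0 x = 1 := by
  obtain ⟨u, -, hconv⟩ := hS
  have hx : x ∈ NonCoincident 3 0 := by
    rw [mem_nonCoincident]; intro i; exact Fin.elim0 i
  have h := (hconv 0).tendsto_at hx
  have h1 : Tendsto (fun k => rescaledCorrelator (criticalCorr 3) rhoPin 0 (u k) x) atTop (𝓝 1) := by
    refine tendsto_const_nhds.congr fun k => ?_
    rw [rescaledCorrelator_apply, pow_zero, one_mul, criticalCorr_orderZero_eq_one]
  exact tendsto_nhds_unique h h1

/-- Odd orders of a cluster point vanish on non-coincident configurations (`m*(β_c) = 0` on `ℤ³`: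
`criticalCorr_eq_zero_of_odd`). [cite: AizenmanDuminilCopinSidoraviciusCMP2015, Thm. 1.2] -/
theorem IsClusterPoint.eq_zero_of_odd {S : CorrFamily 3} (hS : IsClusterPoint S) {n : ℕ} (hn : Odd n)
    {x : Fin n → EuclideanSpace ℝ (Fin 3)} (hx : x ∈ NonCoincident 3 n) : S n x = 0 := by
  obtain ⟨u, -, hconv⟩ := hS
  have h := (hconv n).tendsto_at hx
  have h0 : Tendsto (fun k => rescaledCorrelator (criticalCorr 3) rhoPin n (u k) x) atTop (𝓝 0) := by
    refine tendsto_const_nhds.congr fun k => ?_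
    rw [rescaledCorrelator_apply, criticalCorr_eq_zero_of_odd (d := 3) le_rfl hn, mul_zero]
  exact tendsto_nhds_unique h h0

/-- A REGULAR cluster point vanishes identically at odd orders (on `NonCoincident` by the lattice, off
it by normalisation). [folklore] -/
theorem eq_zero_of_odd_of_regular {S : CorrFamily 3} (hS : IsClusterPoint S) (hreg : IsRegular S)
    {n : ℕ} (hn : Odd n) (x : Fin n → EuclideanSpace ℝ (Fin 3)) : S n x = 0 := by
  by_cases hx : x ∈ NonCoincident 3 n
  · exact hS.eq_zero_of_odd hn hx
  · exact hreg.1 n x hx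

/-! ### The open covariance / uniqueness stubs, cut down to their true locus: even orders `≥ 4` -/

/-- **STUB 5′ — INVERSION COVARIANCE OF INTERACTING REGULAR CLUSTER POINTS AT EVEN ORDERS `≥ 4`
(open, size XL; the HARDEST stub — card `invert-the-cluster-points`' (I𝒞) restricted to the interacting
stratum, with `Δ` pinned by the two-point law, and cut down (reshape 2026-08-16) to the orders where it
has content: orders `0`, odd and `2` are theorems, `isInversionCovariant_of_ge_four` below; cf. the
standing disprover's `Negative/InversionContent.lean`).** A regular (normalised, continuous off
diagonals, translation invariant) cluster point of the pinned zoom whose two-point function is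
`‖x−y‖^{-2Δ}` and whose connected four-point function does not vanish identically satisfies the
inversion identity `S_{2m}(ι x) = ∏ᵢ‖xᵢ‖^{2Δ} · S_{2m}(x)` at every non-coincident configuration
avoiding the origin, for every `m ≥ 2`. NO engine is claimed (candidates on file: sphere-RP inheritance
`PositivityBegetsConformality` r2, nine-mirror OS analyticity + one-point jet of line `one-map-one-jet`,
current re-embedding `CurrentConnectionInvariance`). What does NOT suffice: every closed inherited
constraint (Euclid, exact scale covariance, RP in all planes, GKS/Lebowitz signs, pairing bounds) is
passed by non-Möbius families (`ScaleCovarianceNotMoebius_holds`), and the stub is FALSE without the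
lattice provenance `IsClusterPoint` (refuter, landed `Negative/StubsWithoutLattice.lean`,
`Negative/StubsNeedLattice.lean`); it is implied by the crux (landed `Negative/PinnedClusterPoints.lean`,
`stub5_of_crux`). [cite: DuminilCopinICM2022, §8.1 p. 25 and §8.4 p. 29]
[cite: PolandRychkovVichi2019, §II eq. (2)] [cite: Polyakov1970] -/
theorem stub_interactingInversion_ge_four :
    ∀ (Δ : ℝ) (S : CorrFamily 3), IsClusterPoint S → IsRegular S →
      (∀ x ∈ NonCoincident 3 2, S 2 x = ‖x 0 - x 1‖ ^ (-(2 * Δ))) →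
      HasNontrivialU4 S →
      ∀ m : ℕ, 2 ≤ m → ∀ x : Fin (2 * m) → EuclideanSpace ℝ (Fin 3), x ∈ NonCoincident 3 (2 * m) →
        (∀ i, x i ≠ 0) →
        S (2 * m) (fun i => EuclideanGeometry.inversion 0 1 (x i)) =
          (∏ i, ‖x i‖ ^ (2 * Δ)) * S (2 * m) x := by
  sorry

/-- **STUB 6′ — UNIQUENESS ANCHORED AT AN INTERACTING CLUSTER POINT, AT EVEN ORDERS `≥ 4` (open, size
XL; card `invert-the-cluster-points`' (U𝒞) on the interacting stratum, cut down (reshape 2026-08-16)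
to the orders where it has content: at orders `0`, odd and `2` any two regular cluster points with the
pure-power pair function agree, `eqOn_of_ge_four` below).** If a regular cluster point `S₁` of the
pinned zoom is interacting, then every regular cluster point `S₂` with the same pure-power two-point
function agrees with `S₁` on the non-coincident `2m`-point configurations, `m ≥ 2`. It says: interacting
cluster points do not DRIFT, and free and interacting cluster points do not COEXIST (a uniform-in-`L`
far-merging / `L ≡ 2` statement on the host route excludes the latter). Implied by the crux (landed
`Negative/PinnedClusterPoints.lean`, `stub6_of_crux`); FALSE without `IsClusterPoint` (landed
`Negative/StubsWithoutLattice.lean`). Why it might fail: no lattice mechanism pins the interacting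
subsequential limits of `ℤ³` to one family; a log-periodic drift between distinct interacting
scale-covariant families is not excluded by any theorem. [cite: KosPolandSimmonsDuffinVichi2016]
[cite: DuminilCopinICM2022, §8.4 p. 29 ("proving that these scaling limits indeed exist")] -/
theorem stub_interactingUnique_ge_four :
    ∀ (Δ : ℝ) (S₁ S₂ : CorrFamily 3), IsClusterPoint S₁ → IsClusterPoint S₂ →
      IsRegular S₁ → IsRegular S₂ →
      (∀ x ∈ NonCoincident 3 2, S₁ 2 x = ‖x 0 - x 1‖ ^ (-(2 * Δ))) →
      (∀ x ∈ NonCoincident 3 2, S₂ 2 x = ‖x 0 - x 1‖ ^ (-(2 * Δ))) →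
      HasNontrivialU4 S₁ → ∀ m : ℕ, 2 ≤ m → (NonCoincident 3 (2 * m)).EqOn (S₁ (2 * m)) (S₂ (2 * m)) := by
  sorry

/-- **Inversion covariance of interacting regular cluster points — the former STUB 5, PROVED modulo
STUB 5′**: orders `0` (both sides `1`), odd (both sides `0`), `2` (the pure power transforms with the
gauge `‖p‖^{2Δ}‖q‖^{2Δ}`, `WickPowerMoebius.powerKernel_inversion`) and coincident configurations
(both sides `0` by normalisation, `ι` being injective) are free. [folklore] -/
theorem isInversionCovariant_of_ge_four {Δ : ℝ} {S : CorrFamily 3} (hS : IsClusterPoint S)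
    (hreg : IsRegular S) (h2 : ∀ x ∈ NonCoincident 3 2, S 2 x = ‖x 0 - x 1‖ ^ (-(2 * Δ)))
    (hU : HasNontrivialU4 S) : IsInversionCovariant Δ S := by
  have hι : Function.Injective (EuclideanGeometry.inversion (0 : EuclideanSpace ℝ (Fin 3)) 1) :=
    EuclideanGeometry.inversion_injective _ one_ne_zero
  intro n x hx0
  rcases Nat.even_or_odd n with ⟨m, hm⟩ | hodd
  · obtain rfl : n = 2 * m := by omega
    by_cases hx : x ∈ NonCoincident 3 (2 * m)
    · rcases Nat.lt_or_ge m 2 with hm2 | hm2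
      · interval_cases m
        · rw [hS.orderZero_eq_one, hS.orderZero_eq_one]
          simp
        · have hιx : (fun i => EuclideanGeometry.inversion 0 1 (x i)) ∈ NonCoincident 3 (2 * 1) :=
            (WickPowerMoebius.comp_mem_nonCoincident_iff hι x).2 hx
          rw [h2 _ hιx, h2 _ hx]
          have hk := WickPowerMoebius.powerKernel_inversion Δ (hx0 0) (hx0 1)
          simp only [powerKernel] at hk
          rw [hk, Fin.prod_univ_two]
      · exact stub_interactingInversion_ge_four Δ S hS hreg h2 hU m hm2 x hx hx0
    · have hιx : (fun i => EuclideanGeometry.inversion 0 1 (x i)) ∉ NonCoincident 3 (2 * m) :=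
        fun h => hx ((WickPowerMoebius.comp_mem_nonCoincident_iff hι x).1 h)
      rw [hreg.1 _ _ hιx, hreg.1 _ _ hx, mul_zero]
  · rw [eq_zero_of_odd_of_regular hS hreg hodd, eq_zero_of_odd_of_regular hS hreg hodd, mul_zero]

/-- **Uniqueness anchored at an interacting cluster point — the former STUB 6, PROVED modulo STUB 6′**:
orders `0`, odd and `2` agree for any two regular cluster points with the pure-power pair function.
[folklore] -/
theorem eqOn_of_ge_four {Δ : ℝ} {S₁ S₂ : CorrFamily 3} (hS₁ : IsClusterPoint S₁) (hS₂ : IsClusterPoint S₂)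
    (hreg₁ : IsRegular S₁) (hreg₂ : IsRegular S₂)
    (h₁ : ∀ x ∈ NonCoincident 3 2, S₁ 2 x = ‖x 0 - x 1‖ ^ (-(2 * Δ)))
    (h₂ : ∀ x ∈ NonCoincident 3 2, S₂ 2 x = ‖x 0 - x 1‖ ^ (-(2 * Δ)))
    (hU₁ : HasNontrivialU4 S₁) : ∀ n, (NonCoincident 3 n).EqOn (S₁ n) (S₂ n) := by
  intro n x hx
  rcases Nat.even_or_odd n with ⟨m, hm⟩ | hodd
  · obtain rfl : n = 2 * m := by omega
    rcases Nat.lt_or_ge m 2 with hm2 | hm2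
    · interval_cases m
      · exact (hS₁.orderZero_eq_one x).trans (hS₂.orderZero_eq_one x).symm
      · exact (h₁ x hx).trans (h₂ x hx).symm
    · exact stub_interactingUnique_ge_four Δ S₁ S₂ hS₁ hS₂ hreg₁ hreg₂ h₁ h₂ hU₁ m hm2 hx
  · exact (hS₁.eq_zero_of_odd hodd hx).trans (hS₂.eq_zero_of_odd hodd hx).symm

/-! ## Proved glue -/

/-- The reference mesh sequence `1/(k+1) → 0⁺`. [folklore] -/
theorem refMesh_tendsto : Tendsto (fun k : ℕ => 1 / ((k : ℝ) + 1)) atTop (𝓝[>] (0 : ℝ)) := by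
  refine tendsto_nhdsWithin_iff.2 ⟨tendsto_one_div_add_atTop_nhds_zero_nat, ?_⟩
  refine Filter.Eventually.of_forall fun k => ?_
  show (0 : ℝ) < 1 / ((k : ℝ) + 1)
  positivity

/-! ## The two branches (card C2, and the interacting branch), kernel-checked -/

/-- **FREE BRANCH (card C2): if no regular cluster point is interacting, the pinned zoom converges to
`W_Δ`, which is non-degenerate and Möbius covariant — STUBS 1–4 only.** The reference cluster point
`S₀` (STUB 1 along `1/(k+1)`) equals `wickPower Δ` (STUB 3 + normalisation); every other regular
cluster point equals it off the diagonals (STUB 3 again), so the subsequence principle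
`hasPointwiseScalingLimit_of_seq_subseq` gives convergence along the full filter; non-degeneracy is
STUB 2, covariance STUB 4. [cite: AizenmanCDM2020, Prop. 7.2 and remark p. 23] -/
theorem pinnedLimit_of_allFree {Δ c : ℝ} (hc : 0 < c)
    (hG : Tendsto (fun y : Site 3 => criticalTwoPoint 3 y * Real.sqrt (∑ i, ((y i : ℝ)) ^ 2) ^ (2 * Δ))
      cofinite (𝓝 c))
    (hfree : ∀ S : CorrFamily 3, IsClusterPoint S → IsRegular S → ¬ HasNontrivialU4 S) :
    ∃ S, PinnedLimit Δ S := by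
  have h2 : ∀ S, IsClusterPoint S → ∀ x ∈ NonCoincident 3 2, S 2 x = ‖x 0 - x 1‖ ^ (-(2 * Δ)) :=
    stub_pinnedTwoPoint Δ c hc hG
  -- every regular cluster point is the Wick power family off the diagonals
  have hW : ∀ S, IsClusterPoint S → IsRegular S →
      ∀ n, ∀ x ∈ NonCoincident 3 n, S n x = wickPower Δ n x := by
    intro S hS hreg
    refine stub_freeClusterPointWick Δ S hS (h2 S hS) fun z hz => ?_
    by_contra hne
    exact hfree S hS hreg ⟨z, hz, hne⟩
  -- a reference cluster point, equal to `wickPower Δ` everywhere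
  obtain ⟨φ₀, S₀, hφ₀, hreg₀, hconv₀⟩ := pinnedZoom_compactness hc hG _ refMesh_tendsto
  have hS₀ : IsClusterPoint S₀ := isClusterPoint_of_subseq refMesh_tendsto hφ₀ hconv₀
  have hS₀W : S₀ = wickPower Δ := by
    funext n x
    by_cases hx : x ∈ NonCoincident 3 n
    · exact hW S₀ hS₀ hreg₀ n x hx
    · rw [hreg₀.1 n x hx, wickPower_of_not_mem hx]
  have hM₀ : IsMoebiusCovariant Δ S₀ := by
    rw [hS₀W]
    exact stub_wickPowerMoebius Δ
  refine ⟨S₀, ?_, isNondegenerateTwoPoint_of_twoPoint (h2 S₀ hS₀), hM₀⟩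
  refine hasPointwiseScalingLimit_of_seq_subseq fun n u hu => ?_
  obtain ⟨φ, S, hφ, hreg, hconv⟩ := pinnedZoom_compactness hc hG u hu
  have hS : IsClusterPoint S := isClusterPoint_of_subseq hu hφ hconv
  exact ⟨φ, hφ, (hconv n).congr_right fun x hx => by
    rw [hW S hS hreg n x hx, hW S₀ hS₀ hreg₀ n x hx]⟩

/-- **INTERACTING BRANCH: an interacting regular cluster point attracts the whole pinned zoom and is
inversion covariant, hence a witness of the crux — STUBS 1′, 2, 5, 6 and the standing disprover's
reduction `moebiusLimit_iff_inversion` (`Negative/CruxInversionOnly.lean`: translations, `O(3)` and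
dilations of a non-degenerate limit of `criticalCorr 3` are FREE given inversion covariance), so that NO
word lemma / item stmt-4726 is needed any more (reshape 2026-08-16).** The conclusion is the crux's
definiens, spelled out (only `MoebiusLimitExists_of` / `MoebiusLimit_of` conclude the crux by name).
[cite: DuminilCopinICM2022, §8.1 p. 25] -/
theorem witness_of_interacting {Δ c : ℝ} (hc : 0 < c)
    (hG : Tendsto (fun y : Site 3 => criticalTwoPoint 3 y * Real.sqrt (∑ i, ((y i : ℝ)) ^ 2) ^ (2 * Δ))
      cofinite (𝓝 c))
    {S₁ : CorrFamily 3} (hS₁ : IsClusterPoint S₁) (hreg₁ : IsRegular S₁) (hU₁ : HasNontrivialU4 S₁) :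
    ∃ (ρ : ℝ → ℝ) (Δ' : ℝ) (S' : CorrFamily 3), (∀ δ ∈ Set.Ioc (0:ℝ) 1, 0 < ρ δ) ∧ 0 < Δ' ∧
      HasPointwiseScalingLimit (criticalCorr 3) ρ S' ∧ IsNondegenerateTwoPoint S' ∧
        IsMoebiusCovariant Δ' S' := by
  have h2 : ∀ S, IsClusterPoint S → ∀ x ∈ NonCoincident 3 2, S 2 x = ‖x 0 - x 1‖ ^ (-(2 * Δ)) :=
    stub_pinnedTwoPoint Δ c hc hG
  have hinv : IsInversionCovariant Δ S₁ :=
    isInversionCovariant_of_ge_four hS₁ hreg₁ (h2 S₁ hS₁) hU₁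
  have hlim : HasPointwiseScalingLimit (criticalCorr 3) rhoPin S₁ := by
    refine hasPointwiseScalingLimit_of_seq_subseq fun n u hu => ?_
    obtain ⟨φ, S, hφ, hreg, hconv⟩ := pinnedZoom_compactness hc hG u hu
    have hS : IsClusterPoint S := isClusterPoint_of_subseq hu hφ hconv
    exact ⟨φ, hφ, (hconv n).congr_right fun x hx =>
      (eqOn_of_ge_four hS₁ hS hreg₁ hreg (h2 S₁ hS₁) (h2 S hS) hU₁ n hx).symm⟩
  exact MoebiusLimitExistsNegative.moebiusLimit_iff_inversion.2
    ⟨rhoPin, Δ, S₁, rhoPin_pos, hlim, isNondegenerateTwoPoint_of_twoPoint (h2 S₁ hS₁), hinv⟩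

/-- A pinned limit gives a WITNESS of the crux (the crux's definiens, spelled out — so that only
`MoebiusLimitExists_of` / `MoebiusLimit_of` conclude the crux BY NAME): `ρ_pin > 0` (`rhoPin_pos`)
and `0 < Δ` is REDUNDANT (landed `Negative/DeltaWindow.lean`: `moebiusLimit_iff_without_delta_pos`,
`Δ ∈ [1/2, 1]` forced by the infrared and Simon–Lieb bounds). [cite: Simon1980, Thm. 1] -/
theorem witness_of_pinnedLimit {Δ : ℝ} {S : CorrFamily 3} (h : PinnedLimit Δ S) :
    ∃ (ρ : ℝ → ℝ) (Δ' : ℝ) (S' : CorrFamily 3), (∀ δ ∈ Set.Ioc (0:ℝ) 1, 0 < ρ δ) ∧ 0 < Δ' ∧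
      HasPointwiseScalingLimit (criticalCorr 3) ρ S' ∧ IsNondegenerateTwoPoint S' ∧
        IsMoebiusCovariant Δ' S' :=
  MoebiusLimitExistsNegative.moebiusLimit_iff_without_delta_pos.2
    ⟨rhoPin, Δ, S, rhoPin_pos, h.1, h.2.1, h.2.2⟩

/-- **Card C3 — FAILURE OF THE CRUX CERTIFIES INTERACTION (kernel-checked modulo STUBS 1–4 only).**
Given the two-point law (item 0634), if the crux fails then some regular cluster point of the pinned
zoom has a non-trivial connected four-point function: an interacting subsequential scaling limit of
the 3D critical Ising correlators exists. [cite: AizenmanCDM2020, Prop. 7.2 and remark p. 23] -/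
theorem interacting_clusterPoint_of_not_crux
    (h2pt : Summit.CriticalPhenomena.Ising3DConformalLimit.Theses.IsingEuclidUpgrade.IsingEuclidUpgradeR2RotInvPowerLaw)
    (hnot : ¬ Summit.CriticalPhenomena.Ising3DConformalLimit.Theses.EnergyNotSigmaSquared.MoebiusLimit) :
    ∃ S : CorrFamily 3, IsClusterPoint S ∧ IsRegular S ∧ HasNontrivialU4 S := by
  obtain ⟨Δ, c, hc, hG⟩ := h2pt
  by_contra h
  push Not at h
  obtain ⟨S, hS⟩ := pinnedLimit_of_allFree hc hG h
  exact hnot (witness_of_pinnedLimit hS)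

/-! ## The composition: STUBS 1′, 5, 6 (open) + landed stubs 2–4 and sub-goals + item 0634 ⇒ the crux, BY NAME -/

/-- **`MoebiusLimitExists` from the stubs and the two-point law (item stmt-0634, by name)** — THE
SKELETON THEOREM (reshape 2026-08-16: the word-lemma item stmt-4726 is no longer a hypothesis). Case
split on whether some regular cluster point of the pinned zoom is interacting: if so,
`witness_of_interacting` (STUBS 1′, 2, 5, 6 + `moebiusLimit_iff_inversion`); if not,
`pinnedLimit_of_allFree` (STUBS 1′–4) and `witness_of_pinnedLimit`.
[cite: DuminilCopinICM2022, §8.1 eq. (8.1)–(8.2) and §8.4 p. 29] -/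
theorem MoebiusLimitExists_of
    (h2pt : Summit.CriticalPhenomena.Ising3DConformalLimit.Theses.IsingEuclidUpgrade.IsingEuclidUpgradeR2RotInvPowerLaw) :
    Summit.CriticalPhenomena.Ising3DConformalLimit.Theses.PerfectScreening.MoebiusLimitExists := by
  obtain ⟨Δ, c, hc, hG⟩ := h2pt
  by_cases hint : ∃ S₁ : CorrFamily 3, IsClusterPoint S₁ ∧ IsRegular S₁ ∧ HasNontrivialU4 S₁
  · obtain ⟨S₁, hS₁, hreg₁, hU₁⟩ := hint
    exact witness_of_interacting hc hG hS₁ hreg₁ hU₁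
  · push Not at hint
    obtain ⟨S, hS⟩ := pinnedLimit_of_allFree hc hG hint
    exact witness_of_pinnedLimit hS

/-- The same composition concluding the HOST-ROUTE spelling `EnergyNotSigmaSquared.MoebiusLimit`
(the two decls are one term; item stmt-CriticalPhenomena-1344). [folklore] -/
theorem MoebiusLimit_of
    (h2pt : Summit.CriticalPhenomena.Ising3DConformalLimit.Theses.IsingEuclidUpgrade.IsingEuclidUpgradeR2RotInvPowerLaw) :
    Summit.CriticalPhenomena.Ising3DConformalLimit.Theses.EnergyNotSigmaSquared.MoebiusLimit :=
  MoebiusLimitExists_of h2pt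

end Summit.CriticalPhenomena.Ising3DConformalLimit.MoebiusLimitExistsOnlyInteraction

end
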